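import Summits.NavierStokesRegularity.NavierStokesRegularity.Theorems.HubbleDynamoNoSelfExcitedDynamoEnstrophyFloor
import HarnessLib

/-!
# Crux `NoSelfExcitedDynamo` (stmt-NavierStokesRegularity-1934), line `registered` v16: the SHARP
  enstrophy floor `K_S⁶ E(s)² ≥ 64/27` and the sharp small-enstrophy regime

Theorems file (lands `--supports stmt-NavierStokesRegularity-1934`; sub-goals `enstrophyFloorSharp`,
`smallEnstrophyRegimeSharp`, and the bridges for the line's open stub G⁗). Notation as in
`HubbleDynamoNoSelfExcitedDynamoEnstrophyFloor.lean`: `(W, Q)` an eternal classical solution of Leray's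
backward system on `ℝ × ℝ³` in the uniform profile class, `E(s) = ∫‖curl W(s)‖²`,
`D_F(s) = ∫|D curl W(s)|²_F`, `S(s) = ∫⟪Ω,(DW)Ω⟫`, `K_S` Mathlib's Gagliardo–Nirenberg–Sobolev
constant, `k = K_S⁶`.

The sibling file used the AM–GM cut `S ≤ (kE³ + 3D_F)/4` (threshold `kE² < ½`). The OPTIMAL Young
weights spend the whole dissipation: from `S⁴ ≤ kE³D_F³` (`floor_stretch_pow_four_le`),
`S ≤ D_F + (27/256) k E³` (AM–GM for `{(27/64)kE³, (4/3)D_F, (4/3)D_F, (4/3)D_F}`), so the exact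
identity `½E′ = S − D_F − ¼E` gives

  `½E′ ≤ −¼E (1 − (27/64) k E²)`,

and the threshold of the method becomes `K_S⁶E² < 64/27` (a factor `(128/27)^{1/2} ≈ 2.18` in `E`
over the sibling file):
* `smallEnstrophyRegimeSharp`: if `K_S⁶E(s)² ≤ θ` for all `s` with `θ < 64/27`, then `W ≡ 0`
  (no recurrence; backward Grönwall p146799 + curl-free Liouville p146851);
* `enstrophyFloorSharp`: if `W` is uniformly recurrent and `K_S⁶E(s₀)² < 64/27` at ONE time, then
  `W ≡ 0` (first-exit bootstrap, linear-in-time decay, `stub_recurrentVanishingOfEnstrophyDecay`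
  p165776). So a uniformly recurrent counterexample keeps `E(s) ≥ (8/(3√3)) K_S⁻³` at every time.
* Bridges: the line's open stub G⁗ ("no uniformly recurrent eternal profile-class solution with
  `K_S⁶E(s)² ≥ 64/27` for all `s`") ⇔ G″ ⇔ crux; node `RecurrentLiouville` (stmt-1589) ⇒ G⁗.

## References

* J. Leray, Acta Math. 63 (1934), §20. [Leray1934]
* L. C. Evans, *Partial Differential Equations*, 2nd ed. (2010), §5.6.1, App. B.2 (Young with ε).
* G. Koch, N. Nadirashvili, G. Seregin, V. Šverák, Acta Math. 203 (2009) = arXiv:0709.3599.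
  [KochNadirashviliSereginSverak2009]
-/

noncomputable section

-- tree namespace `Summit.<S>.<S>.Theorems…` (summit = sub-problem), as in every Theorems file of this crux
set_option linter.dupNamespace false

namespace Summit.NavierStokesRegularity.NavierStokesRegularity.Theorems.NoSelfExcitedDynamo.Registered

open Set MeasureTheory Filter Topology InnerProductSpace Function
open scoped RealInnerProductSpace Laplacian ContDiff NNReal ENNReal
open Literature.Analysis.FluidPDE

/-! ### The optimal Young cut and the sharp integral inequality (pure real analysis) -/

/-- **Optimal Young cut.** If `x⁴ ≤ k e³ d³` with `k, e, d ≥ 0` then `x ≤ d + (27/256) k e³`: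
AM–GM `bootstrap_amgm` for `a = (27/64) k e³`, `d' = (4/3) d` (so that `a d'³ = k e³ d³` and
`(a + 3d')/4 = d + (27/256) k e³`). -/
theorem sharp_stretch_le {k e d x : ℝ} (hk : 0 ≤ k) (he : 0 ≤ e) (hd : 0 ≤ d)
    (hx : x ^ 4 ≤ k * e ^ 3 * d ^ 3) : x ≤ d + 27 / 256 * k * e ^ 3 := by
  have h := bootstrap_amgm (a := 27 / 64 * k * e ^ 3) (d := 4 / 3 * d) (x := x) (by positivity)
    (by positivity) (by nlinarith [hx])
  linarith

/-- Pointwise bound on the enstrophy integrand with the optimal cut: if `x⁴ ≤ k e³ d³` with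
`k, e, d ≥ 0` and `(27/64) k e² ≤ 1 − δ`, then `x − d − ¼e ≤ −(δ/4) e`. -/
theorem sharp_integrand_le {k e d x δ : ℝ} (hk : 0 ≤ k) (he : 0 ≤ e) (hd : 0 ≤ d)
    (hx : x ^ 4 ≤ k * e ^ 3 * d ^ 3) (hke : 27 / 64 * k * e ^ 2 ≤ 1 - δ) :
    x - d - (1 / 4) * e ≤ -(δ / 4) * e := by
  have h1 := sharp_stretch_le hk he hd hx
  have h2 : 27 / 256 * k * e ^ 3 ≤ (1 - δ) / 4 * e := by
    have h3 : 27 / 256 * k * e ^ 3 = (27 / 64 * k * e ^ 2) / 4 * e := by ring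
    rw [h3]
    exact mul_le_mul_of_nonneg_right (by linarith) he
  linarith

/-- **Sharp increment bound.** Under `k ≥ 0`, `E` continuous and nonnegative, `D ≥ 0`,
`S⁴ ≤ k E³ D³` and the evolution identity with interval-integrable integrand: on every interval
`a ≤ b` on whose interior `(27/64) k E² ≤ 1 − δ` one has `E b − E a ≤ −(δ/2) ∫_a^b E`. -/
theorem sharp_increment_le {E D S : ℝ → ℝ} {k δ : ℝ} (hk : 0 ≤ k) (hE : Continuous E)
    (hE0 : ∀ s, 0 ≤ E s) (hD0 : ∀ s, 0 ≤ D s) (hS : ∀ s, S s ^ 4 ≤ k * E s ^ 3 * D s ^ 3)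
    (hid : ∀ s₀ s₁ : ℝ, s₀ ≤ s₁ →
      IntervalIntegrable (fun s => S s - D s - (1 / 4) * E s) volume s₀ s₁ ∧
      E s₁ - E s₀ = 2 * ∫ s in s₀..s₁, (S s - D s - (1 / 4) * E s))
    {a b : ℝ} (hab : a ≤ b) (hsmall : ∀ u ∈ Ioo a b, 27 / 64 * k * E u ^ 2 ≤ 1 - δ) :
    E b - E a ≤ -(δ / 2) * ∫ s in a..b, E s := by
  obtain ⟨hint, heq⟩ := hid a b hab
  have hcont : Continuous fun s => -(δ / 4) * E s := by fun_prop
  have hmono : (∫ s in a..b, (S s - D s - (1 / 4) * E s)) ≤ ∫ s in a..b, -(δ / 4) * E s :=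
    intervalIntegral.integral_mono_on_of_le_Ioo hab hint (hcont.intervalIntegrable _ _)
      fun u hu => sharp_integrand_le hk (hE0 u) (hD0 u) (hS u) (hsmall u hu)
  rw [intervalIntegral.integral_const_mul] at hmono
  linarith

/-- Monotonicity from the increment bound with rate `c ≥ 0` on `[s₀, ∞)`. -/
theorem sharp_antitoneOn (E : ℝ → ℝ) (s₀ c : ℝ) (hc : 0 ≤ c) (hE0 : ∀ s, 0 ≤ E s)
    (hinc : ∀ a b, s₀ ≤ a → a ≤ b → E b - E a ≤ -c * ∫ s in a..b, E s) :
    AntitoneOn E (Ici s₀) := by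
  intro a ha b _ hab
  have hint : 0 ≤ ∫ s in a..b, E s := intervalIntegral.integral_nonneg hab fun u _ => hE0 u
  have h := hinc a b ha hab
  nlinarith

/-- Linear-in-time decay with rate `c ≥ 0`: `E b (1 + c (b − s₀)) ≤ E s₀` for `b ≥ s₀`. -/
theorem sharp_linear_bound (E : ℝ → ℝ) (s₀ c : ℝ) (hc : 0 ≤ c) (hE : Continuous E)
    (hE0 : ∀ s, 0 ≤ E s) (hinc : ∀ a b, s₀ ≤ a → a ≤ b → E b - E a ≤ -c * ∫ s in a..b, E s)
    {b : ℝ} (hb : s₀ ≤ b) : E b * (1 + c * (b - s₀)) ≤ E s₀ := by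
  have hanti := sharp_antitoneOn E s₀ c hc hE0 hinc
  have h1 : (b - s₀) * E b ≤ ∫ s in s₀..b, E s := by
    have h2 : ∫ _ in s₀..b, E b = (b - s₀) * E b := by
      simp only [intervalIntegral.integral_const, smul_eq_mul]
    rw [← h2]
    exact intervalIntegral.integral_mono_on hb intervalIntegrable_const (hE.intervalIntegrable _ _)
      fun u hu => hanti (mem_Ici.2 hu.1) (mem_Ici.2 hb) hu.2
  have h3 := hinc s₀ b le_rfl hb
  nlinarith

/-- **Sharp bootstrap** (pure real analysis). With `E` continuous, `0 ≤ E`, `0 ≤ D`,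
`S⁴ ≤ k E³ D³` (`k ≥ 0`) and the evolution identity, if `(27/64) k E(s₀)² < 1` at one time then
`E(s) → 0` as `s → +∞`: with `δ = (1 − (27/64)kE(s₀)²)/2` the first-exit argument `bootstrap_trap`
keeps `(27/64)kE² < 1 − δ` on `[s₀, ∞)`, so `sharp_increment_le` and `sharp_linear_bound` apply. -/
theorem sharp_bootstrap (E D S : ℝ → ℝ) (k : ℝ) (hk : 0 ≤ k) (hE : Continuous E)
    (hE0 : ∀ s, 0 ≤ E s) (hD0 : ∀ s, 0 ≤ D s) (hS : ∀ s, S s ^ 4 ≤ k * E s ^ 3 * D s ^ 3)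
    (hid : ∀ s₀ s₁ : ℝ, s₀ ≤ s₁ →
      IntervalIntegrable (fun s => S s - D s - (1 / 4) * E s) volume s₀ s₁ ∧
      E s₁ - E s₀ = 2 * ∫ s in s₀..s₁, (S s - D s - (1 / 4) * E s))
    (s₀ : ℝ) (hs₀ : 27 / 64 * k * E s₀ ^ 2 < 1) :
    ∀ ε : ℝ, 0 < ε → ∃ T : ℝ, ∀ s, T ≤ s → E s < ε := by
  intro ε hε
  set δ : ℝ := (1 - 27 / 64 * k * E s₀ ^ 2) / 2 with hδ
  have hδ0 : 0 < δ := by rw [hδ]; linarith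
  have hstart : 27 / 64 * k * E s₀ ^ 2 < 1 - δ := by rw [hδ]; linarith
  -- the smallness persists on `[s₀, ∞)`
  have hsmall : ∀ t, s₀ ≤ t → 27 / 64 * k * E t ^ 2 < 1 - δ :=
    bootstrap_trap (f := fun t => 27 / 64 * k * E t ^ 2) (by fun_prop)
      (fun t ht h => by
        have h1 := sharp_increment_le hk hE hE0 hD0 hS hid ht h
        have h2 : 0 ≤ ∫ s in s₀..t, E s := intervalIntegral.integral_nonneg ht fun u _ => hE0 u
        have h3 : E t ≤ E s₀ := by nlinarith
        have h4 : E t ^ 2 ≤ E s₀ ^ 2 := pow_le_pow_left₀ (hE0 t) h3 2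
        nlinarith)
      hstart
  -- increments with rate `δ/2` on `[s₀, ∞)`
  have hinc : ∀ a b, s₀ ≤ a → a ≤ b → E b - E a ≤ -(δ / 2) * ∫ s in a..b, E s :=
    fun a b ha hab => sharp_increment_le hk hE hE0 hD0 hS hid hab
      fun u hu => (hsmall u (ha.trans hu.1.le)).le
  refine ⟨s₀ + (E s₀ / ε) / (δ / 2) + 1, fun s hs => ?_⟩
  have hEε : 0 ≤ E s₀ / ε := div_nonneg (hE0 s₀) hε.le
  have hq : 0 ≤ (E s₀ / ε) / (δ / 2) := div_nonneg hEε (by positivity)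
  have hs₀s : s₀ ≤ s := by linarith
  have h1 := sharp_linear_bound E s₀ (δ / 2) (by positivity) hE hE0 hinc hs₀s
  by_contra hcon
  push Not at hcon
  -- `δ/2 · (s − s₀) ≥ E s₀ / ε`, hence `E s (1 + E s₀/ε) ≤ E s₀`, contradicting `ε ≤ E s`
  have h2 : E s₀ / ε ≤ δ / 2 * (s - s₀) := by
    have h3 : (E s₀ / ε) / (δ / 2) ≤ s - s₀ := by linarith
    have h4 := mul_le_mul_of_nonneg_left h3 (by positivity : (0 : ℝ) ≤ δ / 2)
    rwa [mul_div_cancel₀ _ (by positivity : (δ / 2 : ℝ) ≠ 0)] at h4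
  have h5 : E s * (1 + E s₀ / ε) ≤ E s₀ :=
    (mul_le_mul_of_nonneg_left (by linarith : 1 + E s₀ / ε ≤ 1 + δ / 2 * (s - s₀)) (hE0 s)).trans h1
  have h6 : ε * (1 + E s₀ / ε) = ε + E s₀ := by field_simp
  have h7 : ε * (1 + E s₀ / ε) ≤ E s * (1 + E s₀ / ε) :=
    mul_le_mul_of_nonneg_right hcon (by linarith)
  linarith

/-! ### The sharp small-enstrophy regime (no recurrence) -/

/-- **The sharp small-enstrophy regime** (sub-goal `smallEnstrophyRegimeSharp`). An eternal classical
solution of Leray's backward system on `ℝ × ℝ³` in the uniform profile class with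
`K_S⁶ (∫‖curl U(s)‖²)² ≤ θ` for all `s`, for some `θ < 64/27`, vanishes identically: with
`δ = 1 − (27/64)θ > 0`, `sharp_increment_le` gives `E(s₁) − E(s₀) ≤ −(δ/2)∫_{s₀}^{s₁}E` for the
bounded enstrophy (`stub_enstrophyEvolution`, `floor_stretch_pow_four_le`), the backward Grönwall
lemma `stub_backwardGronwall` kills `E`, and `stub_curlFreeLiouville` finishes. -/
theorem smallEnstrophyRegimeSharp :
    ∀ (U : ℝ → EuclideanSpace ℝ (Fin 3) → EuclideanSpace ℝ (Fin 3)) (P : ℝ → EuclideanSpace ℝ (Fin 3) → ℝ),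
      IsBackwardLeraySolutionOn univ 1 U P →
      (∀ k : ℕ, ∃ K : ℝ, ∀ s y, (1 + ‖y‖) ^ (k + 1) * ‖iteratedFDeriv ℝ k (U s) y‖ ≤ K) →
      (∃ θ : ℝ, θ < 64 / 27 ∧ ∀ s, ((SNormLESNormFDerivOfEqConst (EuclideanSpace ℝ (Fin 3))
          (volume : Measure (EuclideanSpace ℝ (Fin 3))) 2 : ℝ≥0) : ℝ) ^ 6 *
        (∫ y, ‖curl (U s) y‖ ^ 2) ^ 2 ≤ θ) →
      ∀ s y, U s y = 0 := by
  intro U P hL hprof hsmall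
  obtain ⟨θ, hθ, hsmall⟩ := hsmall
  set KS : ℝ := ((SNormLESNormFDerivOfEqConst (EuclideanSpace ℝ (Fin 3))
      (volume : Measure (EuclideanSpace ℝ (Fin 3))) 2 : ℝ≥0) : ℝ) with hKS
  set E : ℝ → ℝ := fun s => ∫ y, ‖curl (U s) y‖ ^ 2 with hE
  set D : ℝ → ℝ := fun s => ∫ y, frobeniusNormSq (fderiv ℝ (curl (U s)) y) with hD
  set S : ℝ → ℝ := fun s => ∫ y, ⟪curl (U s) y, fderiv ℝ (U s) y (curl (U s) y)⟫ with hS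
  obtain ⟨hint, ⟨M, hM⟩, ⟨B, hB⟩, hev⟩ := stub_enstrophyEvolution U P hL hprof
  have hstretch : ∀ s, S s ^ 4 ≤ KS ^ 6 * E s ^ 3 * D s ^ 3 := floor_stretch_pow_four_le U P hL hprof
  have hE0 : ∀ s, 0 ≤ E s := fun s => integral_nonneg fun y => sq_nonneg _
  have hD0 : ∀ s, 0 ≤ D s := fun s => integral_nonneg fun y => frobeniusNormSq_nonneg _
  have hEc : Continuous E := by
    have hL' : LipschitzWith ⟨max B 0, le_max_right _ _⟩ E :=
      LipschitzWith.of_dist_le_mul fun s₁ s₀ => by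
        rw [Real.dist_eq, Real.dist_eq]
        exact (hB s₀ s₁).trans (mul_le_mul_of_nonneg_right (le_max_left _ _) (abs_nonneg _))
    exact hL'.continuous
  set δ : ℝ := 1 - 27 / 64 * θ with hδ
  have hδ0 : 0 < δ / 2 := by rw [hδ]; linarith
  have hincr : ∀ s₀ s₁ : ℝ, s₀ ≤ s₁ → E s₁ - E s₀ ≤ -(δ / 2) * ∫ s in s₀..s₁, E s :=
    fun s₀ s₁ h01 => sharp_increment_le (by positivity) hEc hE0 hD0 hstretch hev h01 fun u _ => by
      have h1 := hsmall u
      have h2 : 27 / 64 * KS ^ 6 * E u ^ 2 = 27 / 64 * (KS ^ 6 * E u ^ 2) := by ring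
      rw [h2, hδ]
      linarith
  have hEz : ∀ s, E s = 0 := stub_backwardGronwall E (δ / 2) M hδ0 hE0 hM hincr
  have hcurl : ∀ s y, curl (U s) y = 0 := by
    intro s
    have hUs : ContDiff ℝ ∞ (U s) := hL.smooth_velocity.contDiff_slice (mem_univ s)
    have hΩc : Continuous (curl (U s)) := (contDiff_curl (n := 0) (hUs.of_le (by norm_cast))).continuous
    exact backusRegime_eq_zero_of_integral_sq_norm_eq_zero hΩc (hint s) (hEz s)
  exact stub_curlFreeLiouville U P hL hprof hcurl

/-! ### The sharp enstrophy floor of a uniformly recurrent counterexample -/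

/-- **The sharp enstrophy floor** (sub-goal `enstrophyFloorSharp`). A UNIFORMLY RECURRENT eternal
classical solution of Leray's backward system on `ℝ × ℝ³` in the uniform profile class with
`K_S⁶ (∫‖curl W(s₀)‖²)² < 64/27` at ONE time vanishes identically (`sharp_bootstrap` then
`stub_recurrentVanishingOfEnstrophyDecay`). Equivalently, a uniformly recurrent counterexample to the
crux keeps `K_S⁶ E(s)² ≥ 64/27`, i.e. `E(s) ≥ (8/(3√3)) K_S⁻³`, at every similarity time. -/
theorem enstrophyFloorSharp :
    ∀ (W : ℝ → EuclideanSpace ℝ (Fin 3) → EuclideanSpace ℝ (Fin 3)) (Q : ℝ → EuclideanSpace ℝ (Fin 3) → ℝ),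
      IsBackwardLeraySolutionOn univ 1 W Q →
      (∀ k : ℕ, ∃ K : ℝ, ∀ s y, (1 + ‖y‖) ^ (k + 1) * ‖iteratedFDeriv ℝ k (W s) y‖ ≤ K) →
      (∀ ε : ℝ, 0 < ε → ∀ R : ℝ, ∃ L : ℝ, 0 < L ∧ ∀ a : ℝ, ∃ σ ∈ Icc a (a + L),
        ∀ s ∈ Icc (-R) R, ∀ y ∈ Metric.closedBall (0 : EuclideanSpace ℝ (Fin 3)) R,
          ‖W (s + σ) y - W s y‖ < ε) →
      (∃ s₀ : ℝ, ((SNormLESNormFDerivOfEqConst (EuclideanSpace ℝ (Fin 3))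
          (volume : Measure (EuclideanSpace ℝ (Fin 3))) 2 : ℝ≥0) : ℝ) ^ 6 *
        (∫ y, ‖curl (W s₀) y‖ ^ 2) ^ 2 < 64 / 27) →
      ∀ s y, W s y = 0 := by
  intro W Q hW hprof hrec hsmall
  set KS : ℝ := ((SNormLESNormFDerivOfEqConst (EuclideanSpace ℝ (Fin 3))
      (volume : Measure (EuclideanSpace ℝ (Fin 3))) 2 : ℝ≥0) : ℝ) with hKS
  set E : ℝ → ℝ := fun s => ∫ y, ‖curl (W s) y‖ ^ 2 with hE
  set D : ℝ → ℝ := fun s => ∫ y, frobeniusNormSq (fderiv ℝ (curl (W s)) y) with hD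
  set S : ℝ → ℝ := fun s => ∫ y, ⟪curl (W s) y, fderiv ℝ (W s) y (curl (W s) y)⟫ with hS
  obtain ⟨s₀, hs₀⟩ := hsmall
  obtain ⟨-, -, ⟨B, hB⟩, hev⟩ := stub_enstrophyEvolution W Q hW hprof
  have hstretch : ∀ s, S s ^ 4 ≤ KS ^ 6 * E s ^ 3 * D s ^ 3 := floor_stretch_pow_four_le W Q hW hprof
  have hEc : Continuous E := by
    have hL' : LipschitzWith ⟨max B 0, le_max_right _ _⟩ E :=
      LipschitzWith.of_dist_le_mul fun s₁ s₀ => by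
        rw [Real.dist_eq, Real.dist_eq]
        exact (hB s₀ s₁).trans (mul_le_mul_of_nonneg_right (le_max_left _ _) (abs_nonneg _))
    exact hL'.continuous
  have hs₀' : 27 / 64 * KS ^ 6 * E s₀ ^ 2 < 1 := by
    have h2 : 27 / 64 * KS ^ 6 * E s₀ ^ 2 = 27 / 64 * (KS ^ 6 * E s₀ ^ 2) := by ring
    rw [h2]
    linarith
  have hdecay : ∀ ε : ℝ, 0 < ε → ∃ T : ℝ, ∀ s, T ≤ s → E s < ε :=
    sharp_bootstrap E D S (KS ^ 6) (by positivity) hEc (fun s => integral_nonneg fun y => sq_nonneg _)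
      (fun s => integral_nonneg fun y => frobeniusNormSq_nonneg _) hstretch hev s₀ hs₀'
  exact stub_recurrentVanishingOfEnstrophyDecay W Q hW hprof hrec hdecay

/-! ### Bridges: the open stub G⁗ (no uniformly recurrent profile above the sharp floor) ⇔ G″ ⇔ crux -/

/-- **G⁗ ⇒ G″** (sub-goal `noUniformlyRecurrentTypeIProfile_of_noRecurrentProfileAboveSharpFloor`):
if every uniformly recurrent eternal profile-class solution ABOVE the sharp floor vanishes, then every
uniformly recurrent eternal profile-class solution vanishes (`enstrophyFloorSharp` kills the rest). -/
theorem noUniformlyRecurrentTypeIProfile_of_noRecurrentProfileAboveSharpFloor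
    (hG4 : ∀ (W : ℝ → EuclideanSpace ℝ (Fin 3) → EuclideanSpace ℝ (Fin 3)) (Q : ℝ → EuclideanSpace ℝ (Fin 3) → ℝ),
      IsBackwardLeraySolutionOn univ 1 W Q →
      (∀ k : ℕ, ∃ K : ℝ, ∀ s y, (1 + ‖y‖) ^ (k + 1) * ‖iteratedFDeriv ℝ k (W s) y‖ ≤ K) →
      (∀ ε : ℝ, 0 < ε → ∀ R : ℝ, ∃ L : ℝ, 0 < L ∧ ∀ a : ℝ, ∃ σ ∈ Icc a (a + L),
        ∀ s ∈ Icc (-R) R, ∀ y ∈ Metric.closedBall (0 : EuclideanSpace ℝ (Fin 3)) R,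
          ‖W (s + σ) y - W s y‖ < ε) →
      (∀ s, 64 / 27 ≤ ((SNormLESNormFDerivOfEqConst (EuclideanSpace ℝ (Fin 3))
            (volume : Measure (EuclideanSpace ℝ (Fin 3))) 2 : ℝ≥0) : ℝ) ^ 6 *
          (∫ y, ‖curl (W s) y‖ ^ 2) ^ 2) →
      ∀ s y, W s y = 0) :
    ∀ (W : ℝ → EuclideanSpace ℝ (Fin 3) → EuclideanSpace ℝ (Fin 3)) (Q : ℝ → EuclideanSpace ℝ (Fin 3) → ℝ),
      IsBackwardLeraySolutionOn univ 1 W Q →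
      (∀ k : ℕ, ∃ K : ℝ, ∀ s y, (1 + ‖y‖) ^ (k + 1) * ‖iteratedFDeriv ℝ k (W s) y‖ ≤ K) →
      (∀ ε : ℝ, 0 < ε → ∀ R : ℝ, ∃ L : ℝ, 0 < L ∧ ∀ a : ℝ, ∃ σ ∈ Icc a (a + L),
        ∀ s ∈ Icc (-R) R, ∀ y ∈ Metric.closedBall (0 : EuclideanSpace ℝ (Fin 3)) R,
          ‖W (s + σ) y - W s y‖ < ε) →
      ∀ s y, W s y = 0 := by
  intro W Q hW hprof hrec
  by_cases h : ∃ s₀ : ℝ, ((SNormLESNormFDerivOfEqConst (EuclideanSpace ℝ (Fin 3))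
            (volume : Measure (EuclideanSpace ℝ (Fin 3))) 2 : ℝ≥0) : ℝ) ^ 6 *
          (∫ y, ‖curl (W s₀) y‖ ^ 2) ^ 2 < 64 / 27
  · exact enstrophyFloorSharp W Q hW hprof hrec h
  · push Not at h
    exact hG4 W Q hW hprof hrec h

/-- **G⁗ ⇒ crux** (sub-goal `noSelfExcitedDynamo_of_noRecurrentProfileAboveSharpFloor`; the conclusion
is the crux `NoSelfExcitedDynamo` unfolded), through G″ and p160780. -/
theorem noSelfExcitedDynamo_of_noRecurrentProfileAboveSharpFloor
    (hG4 : ∀ (W : ℝ → EuclideanSpace ℝ (Fin 3) → EuclideanSpace ℝ (Fin 3)) (Q : ℝ → EuclideanSpace ℝ (Fin 3) → ℝ),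
      IsBackwardLeraySolutionOn univ 1 W Q →
      (∀ k : ℕ, ∃ K : ℝ, ∀ s y, (1 + ‖y‖) ^ (k + 1) * ‖iteratedFDeriv ℝ k (W s) y‖ ≤ K) →
      (∀ ε : ℝ, 0 < ε → ∀ R : ℝ, ∃ L : ℝ, 0 < L ∧ ∀ a : ℝ, ∃ σ ∈ Icc a (a + L),
        ∀ s ∈ Icc (-R) R, ∀ y ∈ Metric.closedBall (0 : EuclideanSpace ℝ (Fin 3)) R,
          ‖W (s + σ) y - W s y‖ < ε) →
      (∀ s, 64 / 27 ≤ ((SNormLESNormFDerivOfEqConst (EuclideanSpace ℝ (Fin 3))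
            (volume : Measure (EuclideanSpace ℝ (Fin 3))) 2 : ℝ≥0) : ℝ) ^ 6 *
          (∫ y, ‖curl (W s) y‖ ^ 2) ^ 2) →
      ∀ s y, W s y = 0) :
    ∀ u : ℝ → EuclideanSpace ℝ (Fin 3) → EuclideanSpace ℝ (Fin 3),
      IsBoundedAncientMildSolution 1 u →
      (∀ t < 0, AEStronglyMeasurable (u t) volume) → (∃ C : ℝ, HasTypeIDecay C u) →
      ∀ t < 0, u t =ᵐ[volume] (0 : EuclideanSpace ℝ (Fin 3) → EuclideanSpace ℝ (Fin 3)) :=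
  noSelfExcitedDynamo_of_noUniformlyRecurrentTypeIProfile
    (noUniformlyRecurrentTypeIProfile_of_noRecurrentProfileAboveSharpFloor hG4)

/-- **crux ⇒ G⁗** (sub-goal `noRecurrentProfileAboveSharpFloor_of_noSelfExcitedDynamo`; hypothesis =
the crux unfolded), through p160780. So G⁗ ⇔ G″ ⇔ crux. -/
theorem noRecurrentProfileAboveSharpFloor_of_noSelfExcitedDynamo :
    (∀ u : ℝ → EuclideanSpace ℝ (Fin 3) → EuclideanSpace ℝ (Fin 3),
      IsBoundedAncientMildSolution 1 u →
      (∀ t < 0, AEStronglyMeasurable (u t) volume) → (∃ C : ℝ, HasTypeIDecay C u) →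
      ∀ t < 0, u t =ᵐ[volume] (0 : EuclideanSpace ℝ (Fin 3) → EuclideanSpace ℝ (Fin 3))) →
    ∀ (W : ℝ → EuclideanSpace ℝ (Fin 3) → EuclideanSpace ℝ (Fin 3)) (Q : ℝ → EuclideanSpace ℝ (Fin 3) → ℝ),
      IsBackwardLeraySolutionOn univ 1 W Q →
      (∀ k : ℕ, ∃ K : ℝ, ∀ s y, (1 + ‖y‖) ^ (k + 1) * ‖iteratedFDeriv ℝ k (W s) y‖ ≤ K) →
      (∀ ε : ℝ, 0 < ε → ∀ R : ℝ, ∃ L : ℝ, 0 < L ∧ ∀ a : ℝ, ∃ σ ∈ Icc a (a + L),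
        ∀ s ∈ Icc (-R) R, ∀ y ∈ Metric.closedBall (0 : EuclideanSpace ℝ (Fin 3)) R,
          ‖W (s + σ) y - W s y‖ < ε) →
      (∀ s, 64 / 27 ≤ ((SNormLESNormFDerivOfEqConst (EuclideanSpace ℝ (Fin 3))
            (volume : Measure (EuclideanSpace ℝ (Fin 3))) 2 : ℝ≥0) : ℝ) ^ 6 *
          (∫ y, ‖curl (W s) y‖ ^ 2) ^ 2) →
      ∀ s y, W s y = 0 :=
  fun hcrux W Q hW hprof hrec _ => noUniformlyRecurrentTypeIProfile_of_noSelfExcitedDynamo hcrux W Q hW hprof hrec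

/-- **node ⇒ G⁗** (sub-goal `noRecurrentProfileAboveSharpFloor_of_recurrentLiouville`): the node crux
`RecurrentLiouville` (stmt-NavierStokesRegularity-1589) implies the line's open stub, through the crux
(p157812, p160780). -/
theorem noRecurrentProfileAboveSharpFloor_of_recurrentLiouville (h : Theses.SqueezeCycle.RecurrentLiouville) :
    ∀ (W : ℝ → EuclideanSpace ℝ (Fin 3) → EuclideanSpace ℝ (Fin 3)) (Q : ℝ → EuclideanSpace ℝ (Fin 3) → ℝ),
      IsBackwardLeraySolutionOn univ 1 W Q →
      (∀ k : ℕ, ∃ K : ℝ, ∀ s y, (1 + ‖y‖) ^ (k + 1) * ‖iteratedFDeriv ℝ k (W s) y‖ ≤ K) →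
      (∀ ε : ℝ, 0 < ε → ∀ R : ℝ, ∃ L : ℝ, 0 < L ∧ ∀ a : ℝ, ∃ σ ∈ Icc a (a + L),
        ∀ s ∈ Icc (-R) R, ∀ y ∈ Metric.closedBall (0 : EuclideanSpace ℝ (Fin 3)) R,
          ‖W (s + σ) y - W s y‖ < ε) →
      (∀ s, 64 / 27 ≤ ((SNormLESNormFDerivOfEqConst (EuclideanSpace ℝ (Fin 3))
            (volume : Measure (EuclideanSpace ℝ (Fin 3))) 2 : ℝ≥0) : ℝ) ^ 6 *
          (∫ y, ‖curl (W s) y‖ ^ 2) ^ 2) →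
      ∀ s y, W s y = 0 :=
  fun W Q hW hprof hrec _ => noUniformlyRecurrentTypeIProfile_of_recurrentLiouville h W Q hW hprof hrec

end Summit.NavierStokesRegularity.NavierStokesRegularity.Theorems.NoSelfExcitedDynamo.Registered

end
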